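import Summits.QuantumFields.YangMills.Theorems.FlatTubeReductionProfileVolumeGrowth
import Summits.QuantumFields.YangMills.Theorems.FlatTubeReductionGaussianLayerCakeWeighted
import HarnessLib

/-!
# The FP-weighted gauge Gaussian mass at fixed fibres: `∫ fpWeight ε(g)·e^{−β·kinDefect(U,V,g)} dg ≤ 5e·4^{3n}(3n)!·fpZ ε·(π²/12)^n(3L)^{3n}3^{3n}(√β)^{-3n}·(1 + (5√β a)^{3n} + (√β a′)^{3n})`
# — polynomial in the link amplitudes `a, a′`, Gaussian scaling `β^{-3n/2}` explicit, no logarithm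
# (route `FlatTubeReduction`, crux K1 `NearFlatRatioLaw` stmt-QuantumFields-24720; seat `ym-line-ftr-p1` g12; rate twin «ratepack-v3 / frozen fibres»; R2b1 RECORD rung — no summit
# statement is proved here)

WHY (memo `Cruxes/NearFlatRatioLaw/Lines/ratepack-v3-frozen-g12.md` §5.10 (f′)).  The fibre tails of the core (`β‖v̂‖² > T`) and any fibre-localised estimate of the reference density
need the gauge integral of the Gaussian `e^{−β·kinDefect}` against the FP window at FIXED fibres: the unweighted layer cake on the measure `fpWeight·Haar^Λ` with the volume growth of
`…FPLevelSetVolume.integral_fpWeight_kinLevelSet_le` (expanded as in `…ProfileVolumeGrowth`), packaged through `…GaussianLayerCakeWeighted.setIntegral_weighted_tail_le` at level `−1`.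
  ★★ `gauge_gaussian_mass_le`.
HONEST FRAMING: bookkeeping; femto rung R2b1 (RECORD label); not infinite volume, not a gap, not Clay.  No defs, no named facts, no `sorry`.
-/

set_option autoImplicit false

noncomputable section

open MeasureTheory Filter Topology Real Set
open scoped BigOperators ENNReal
open Literature.MathematicalPhysics.QuantumFieldTheory
open Literature.MathematicalPhysics.QuantumLattice

namespace Summit.QuantumFields.YangMills.Theorems.FemtoTransferGap.RateTube

open Summit.QuantumFields.YangMills.Theorems.FemtoTransferGap
open Summit.QuantumFields.YangMills.Theorems.FemtoTransferGap.TwoLattice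
open Summit.QuantumFields.YangMills.Theorems.FemtoTransferGap.TwoLattice.ConstTube
open Summit.QuantumFields.YangMills.Theorems.FemtoTransferGap.TwoLattice.Avg

variable {L : ℕ} [NeZero L]

set_option maxHeartbeats 800000 in
/-- ★★ **FP-weighted gauge Gaussian mass.**  `β > 0`, `‖q(U_e) − 1‖ ≤ a`, `‖q(V_e) − 1‖ ≤ a′` (`a, a′ ≥ 0`), `n = |Λ| − 1`:
`∫ fpWeight ε g·exp(−β·kinDefect U V g) dgaugeMeasure ≤ 5e·4^{3n}·(3n)!·[fpZ ε·(π²/12)^n(3L)^{3n}3^{3n}((√β)⁻¹)^{3n}·(1 + (√β·5a)^{3n} + (√β·a′)^{3n})]`. [cite: Luscher1983, §3] -/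
theorem gauge_gaussian_mass_le {β : ℝ} (hβ : 0 < β) (ε : ℝ) (U V : GaugeConfig 3 L SU2) {a a' : ℝ} (ha0 : 0 ≤ a) (ha0' : 0 ≤ a')
    (ha : ∀ e, ‖su2Quat (U e) - 1‖ ≤ a) (ha' : ∀ e, ‖su2Quat (V e) - 1‖ ≤ a') :
    ∫ g, fpWeight L ε g * Real.exp (-(β * kinDefect L U V g)) ∂gaugeMeasure L ≤
      5 * Real.exp 1 * 4 ^ (3 * Fintype.card {x : Site 3 L // ¬x = 0}) * (3 * Fintype.card {x : Site 3 L // ¬x = 0}).factorial *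
        (fpZ ε * (π ^ 2 / 12) ^ Fintype.card {x : Site 3 L // ¬x = 0} * (3 * (L : ℝ)) ^ (3 * Fintype.card {x : Site 3 L // ¬x = 0}) *
          3 ^ (3 * Fintype.card {x : Site 3 L // ¬x = 0}) * ((Real.sqrt β)⁻¹) ^ (3 * Fintype.card {x : Site 3 L // ¬x = 0}) *
          (1 + (Real.sqrt β * (5 * a)) ^ (3 * Fintype.card {x : Site 3 L // ¬x = 0}) + (Real.sqrt β * a') ^ (3 * Fintype.card {x : Site 3 L // ¬x = 0}))) := by
  haveI : SecondCountableTopology SU2 := secondCountableTopology_su2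
  set n : ℕ := Fintype.card {x : Site 3 L // ¬x = 0} with hn
  set sβ : ℝ := (Real.sqrt β)⁻¹ with hsβ
  have hsβ0 : 0 < sβ := by rw [hsβ]; exact inv_pos.mpr (Real.sqrt_pos.mpr hβ)
  have hββ : Real.sqrt β * sβ = 1 := by rw [hsβ, mul_inv_cancel₀ (Real.sqrt_pos.mpr hβ).ne']
  have hZ0 : 0 ≤ fpZ ε := by unfold fpZ; exact measureReal_nonneg
  -- data for the weighted tail lemma on `gaugeMeasure`: `F = fpWeight`, `σ = e^{-N}`, `N = β·kinDefect`
  have hFm : Measurable (fpWeight L ε) := measurable_fpWeight L ε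
  have hF0 : ∀ g, 0 ≤ fpWeight L ε g := fun g => (fpWeight_mem_Icc L ε g).1
  have hFb : ∀ g, fpWeight L ε g ≤ 1 := fun g => (fpWeight_mem_Icc L ε g).2
  have hNm : Measurable fun g : Site 3 L → SU2 => β * kinDefect L U V g := (continuous_kinDefect_gauge U V).measurable.const_mul β
  have hN0 : ∀ g : Site 3 L → SU2, 0 ≤ β * kinDefect L U V g := fun g => mul_nonneg hβ.le (kinDefect_nonneg _ _ _)
  have hσm : Measurable fun g : Site 3 L → SU2 => Real.exp (-(β * kinDefect L U V g)) := Real.measurable_exp.comp hNm.neg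
  have hσ0 : ∀ g : Site 3 L → SU2, 0 ≤ Real.exp (-(β * kinDefect L U V g)) := fun g => (Real.exp_pos _).le
  have hσup : ∀ g : Site 3 L → SU2, Real.exp (-(β * kinDefect L U V g)) ≤ 1 * Real.exp (-(β * kinDefect L U V g)) := fun g => by rw [one_mul]
  -- volume growth of `fpWeight·Haar` on the level sets, closed form
  set Vg : ℝ := fpZ ε * (π ^ 2 / 12) ^ n * (3 * (L : ℝ)) ^ (3 * n) * 3 ^ (3 * n) * sβ ^ (3 * n) * (1 + (Real.sqrt β * (5 * a)) ^ (3 * n) + (Real.sqrt β * a') ^ (3 * n)) with hVg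
  have hV : ∀ t : ℝ, 0 ≤ t → ∫ g in {g | β * kinDefect L U V g ≤ t}, fpWeight L ε g ∂gaugeMeasure L ≤ Vg * (t + 1) ^ (3 * n) := by
    intro t ht
    have hset : {g : Site 3 L → SU2 | β * kinDefect L U V g ≤ t} = {g | kinDefect L U V g ≤ t / β} := by
      ext g; simp only [Set.mem_setOf_eq]; rw [le_div_iff₀ hβ, mul_comm]
    have hSm : MeasurableSet {g : Site 3 L → SU2 | kinDefect L U V g ≤ t / β} := measurableSet_le (continuous_kinDefect_gauge U V).measurable measurable_const
    rw [hset, ← integral_indicator hSm]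
    have e : ∀ g, Set.indicator {g : Site 3 L → SU2 | kinDefect L U V g ≤ t / β} (fpWeight L ε) g =
        fpWeight L ε g * Set.indicator {g : Site 3 L → SU2 | kinDefect L U V g ≤ t / β} (fun _ => (1 : ℝ)) g := fun g => by
      by_cases hg : g ∈ {g : Site 3 L → SU2 | kinDefect L U V g ≤ t / β}
      · rw [Set.indicator_of_mem hg, Set.indicator_of_mem hg, mul_one]
      · rw [Set.indicator_of_notMem hg, Set.indicator_of_notMem hg, mul_zero]
    rw [integral_congr_ae (ae_of_all _ e)]
    refine (integral_fpWeight_kinLevelSet_le (L := L) ε U V ha ha' (t / β)).trans ?_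
    -- expand the box
    have hD : Real.sqrt (t / β) = Real.sqrt t * sβ := by rw [hsβ, Real.sqrt_div ht, div_eq_mul_inv]
    have h3 := pow_add_three_le (Real.sqrt_nonneg (t / β)) (by positivity : 0 ≤ 5 * a) ha0' (3 * n)
    have ea : Real.sqrt (t / β) ^ (3 * n) = sβ ^ (3 * n) * Real.sqrt t ^ (3 * n) := by rw [hD, mul_pow, mul_comm]
    have eb : (5 * a) ^ (3 * n) = sβ ^ (3 * n) * (Real.sqrt β * (5 * a)) ^ (3 * n) := by
      rw [← mul_pow, ← mul_assoc, mul_comm sβ, hββ, one_mul]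
    have ec : a' ^ (3 * n) = sβ ^ (3 * n) * (Real.sqrt β * a') ^ (3 * n) := by
      rw [← mul_pow, ← mul_assoc, mul_comm sβ, hββ, one_mul]
    have hsq1 : Real.sqrt t ≤ t + 1 := by rw [Real.sqrt_le_left (by linarith)]; nlinarith
    have hst : Real.sqrt t ^ (3 * n) ≤ (t + 1) ^ (3 * n) := pow_le_pow_left₀ (Real.sqrt_nonneg _) hsq1 _
    have hs0 : 0 ≤ sβ ^ (3 * n) := pow_nonneg hsβ0.le _
    have ht1 : 1 ≤ (t + 1) ^ (3 * n) := one_le_pow₀ (by linarith)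
    have e1 : (π ^ 2 / 12 * (3 * L * (Real.sqrt (t / β) + 5 * a + a')) ^ 3) ^ n =
        (π ^ 2 / 12) ^ n * (3 * (L : ℝ)) ^ (3 * n) * (Real.sqrt (t / β) + 5 * a + a') ^ (3 * n) := by
      rw [mul_pow, mul_pow, mul_pow, ← pow_mul, ← pow_mul, mul_assoc]
    rw [ea, eb, ec] at h3
    rw [e1]
    have hK0 : 0 ≤ fpZ ε * ((π ^ 2 / 12) ^ n * (3 * (L : ℝ)) ^ (3 * n)) := by positivity
    have hb0 : 0 ≤ (Real.sqrt β * (5 * a)) ^ (3 * n) := by positivity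
    have hc0 : 0 ≤ (Real.sqrt β * a') ^ (3 * n) := by positivity
    have h4 : sβ ^ (3 * n) * Real.sqrt t ^ (3 * n) ≤ sβ ^ (3 * n) * (t + 1) ^ (3 * n) := mul_le_mul_of_nonneg_left hst hs0
    have h5 : sβ ^ (3 * n) * (Real.sqrt β * (5 * a)) ^ (3 * n) ≤ sβ ^ (3 * n) * (Real.sqrt β * (5 * a)) ^ (3 * n) * (t + 1) ^ (3 * n) :=
      le_mul_of_one_le_right (mul_nonneg hs0 hb0) ht1
    have h6 : sβ ^ (3 * n) * (Real.sqrt β * a') ^ (3 * n) ≤ sβ ^ (3 * n) * (Real.sqrt β * a') ^ (3 * n) * (t + 1) ^ (3 * n) :=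
      le_mul_of_one_le_right (mul_nonneg hs0 hc0) ht1
    have h7 : (Real.sqrt (t / β) + 5 * a + a') ^ (3 * n) ≤
        3 ^ (3 * n) * (sβ ^ (3 * n) * (t + 1) ^ (3 * n) + sβ ^ (3 * n) * (Real.sqrt β * (5 * a)) ^ (3 * n) * (t + 1) ^ (3 * n) +
          sβ ^ (3 * n) * (Real.sqrt β * a') ^ (3 * n) * (t + 1) ^ (3 * n)) :=
      h3.trans (mul_le_mul_of_nonneg_left (by linarith) (by positivity))
    calc fpZ ε * ((π ^ 2 / 12) ^ n * (3 * (L : ℝ)) ^ (3 * n) * (Real.sqrt (t / β) + 5 * a + a') ^ (3 * n))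
        = fpZ ε * ((π ^ 2 / 12) ^ n * (3 * (L : ℝ)) ^ (3 * n)) * (Real.sqrt (t / β) + 5 * a + a') ^ (3 * n) := by ring
      _ ≤ fpZ ε * ((π ^ 2 / 12) ^ n * (3 * (L : ℝ)) ^ (3 * n)) *
            (3 ^ (3 * n) * (sβ ^ (3 * n) * (t + 1) ^ (3 * n) + sβ ^ (3 * n) * (Real.sqrt β * (5 * a)) ^ (3 * n) * (t + 1) ^ (3 * n) +
              sβ ^ (3 * n) * (Real.sqrt β * a') ^ (3 * n) * (t + 1) ^ (3 * n))) := mul_le_mul_of_nonneg_left h7 hK0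
      _ = Vg * (t + 1) ^ (3 * n) := by rw [hVg]; ring
  -- the weighted tail lemma at level `-1` gives the full integral
  have h := setIntegral_weighted_tail_le (gaugeMeasure L) hFm hF0 hFb hNm hN0 hV hσm hσ0 zero_le_one hσup (-1)
  have hfull : {g : Site 3 L → SU2 | (-1 : ℝ) < β * kinDefect L U V g} = Set.univ := by
    ext g; simp only [Set.mem_setOf_eq, Set.mem_univ, iff_true]; linarith [hN0 g]
  rw [hfull, Measure.restrict_univ] at h
  refine h.trans (le_of_eq ?_)
  have e : Real.exp (-((-1 : ℝ) / 2)) * (5 * Real.exp (1 / 2) * 4 ^ (3 * n) * (3 * n).factorial * Vg) = 5 * Real.exp 1 * 4 ^ (3 * n) * (3 * n).factorial * Vg := by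
    have : Real.exp (-((-1 : ℝ) / 2)) * Real.exp (1 / 2) = Real.exp 1 := by rw [← Real.exp_add]; norm_num
    calc Real.exp (-((-1 : ℝ) / 2)) * (5 * Real.exp (1 / 2) * 4 ^ (3 * n) * (3 * n).factorial * Vg)
        = 5 * (Real.exp (-((-1 : ℝ) / 2)) * Real.exp (1 / 2)) * 4 ^ (3 * n) * (3 * n).factorial * Vg := by ring
      _ = _ := by rw [this]
  rw [one_mul, e, hVg]

end Summit.QuantumFields.YangMills.Theorems.FemtoTransferGap.RateTube

end
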